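import Summits.QuantumFields.YangMills.Theorems.VirialFluxGapRingTwistEaterForm
import Summits.QuantumFields.YangMills.Theorems.VirialFluxGapTwistEaterQuaternion
import HarnessLib

/-!
# Quantitative STABILISER RIGIDITY of the twisted flat rings (first half of the slice property `hslice` of the orbit theorem)
# (layer (B), chart-free input, of the DIRECT Laplace road to ⟨stmt-QuantumFields-24204⟩ `VirialFluxGap.SharpTwistedLaplace`)

Helper module (free-hands work of width seat ym-line-sfw-p2-w3 g56, cell ym-idea-1; `--supports 24204`).  The quantitative orbit theorem
✓`QuantitativeLaplace.laplaceMethod_quantitative_orbit(_tube)` needs the SLICE PROPERTY `k · σ(y) = σ(y') ⇒ k ∈ S` GLOBALLY in the gauge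
transformation `k`; its first half is the statement that a gauge transformation which moves a zero `Q` of the twisted deficit `F_z` only a
little is itself close to the (finite, central) stabiliser `{1, −1}`.  Here this is proved CHART-FREE and QUANTITATIVELY, with a constant
linear in `L`:

* §1 (quaternions) ★ `exists_sign_norm_sub_le_of_comm_pure_pair` — if a unit quaternion `v` almost commutes with BOTH members of a pure
  orthonormal pair `(a, n)` (`‖vn − nv‖ ≤ ε₁`, `‖va − av‖ ≤ ε₂`) then `‖v − σ‖ ≤ ε₁ + ε₂` for a sign `σ = ±1` (quantitative twin of
  ✓`QuantitativeLaplace.eq_one_or_neg_one_of_comm_pair`; Lagrange's identity ✓`cross_sq_le_of_comm` + Bessel for the pair);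
* §2 (`SU(2)`) `exists_centreElem_fd_le_of_twistEater` — for a twist-eater pair `c w c⁻¹ = −w`, every `u` with `fd(u w u⁻¹, w) ≤ ε₁`,
  `fd(u c u⁻¹, c) ≤ ε₂` is within `2(ε₁ + ε₂)` (Frobenius) of `centreElem b` for some `b`;
* §3 (rings) ★★ `exists_centreElem_fd_le_of_ringDeficit_eq_zero` — for `L ≥ 2`, `z ≠ 0`, `F_z(Q) = 0` and ANY gauge field `h` with
  `fd((h·Q₀)_e, (Q₀)_e) ≤ δ` on every link of the slice and `fd(h_x g_x h_x⁻¹, g_x) ≤ δ` at every site of the seam: there is `b` with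
  `fd(h_x, centreElem b) ≤ 9L·δ` at EVERY site (comb normal form ✓`exists_combGauge_of_ringDeficit_eq_zero`: the conjugated field
  `t h t⁻¹` is `δ`-constant along tree edges (✓`fd_sub_base_le_of_treeEdge`), almost commutes with a wrap `w_{k₀}` of a twisted direction
  and with the seam constant `c`, and `c w_{k₀} c⁻¹ = −w_{k₀}`);
* §4 ★★ `exists_centreElem_fd_le_sqrt_ringDist` — the same with the chordal ring distance of the Theses (tube/separation currency):
  `fd(h_x, centreElem b) ≤ 18L·√(ringDist(h·Q, Q))`.

Everything here is PROVED; no definitions, no named facts (namespace `Summit.QuantumFields.YangMills.Theorems.VirialFluxGap.RingDeficit`).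
HONEST FRAMING: lattice∕quaternion algebra; ⟨24204⟩, ⟨24319⟩ and every rung stay OPEN; the Yang–Mills mass gap (Clay) is NOT touched; no
summit is proved by a line.

## References
* M. Lüscher, Nucl. Phys. B219 (1983), §2 (twisted boundary conditions remove the zero modes; twist eaters). [Luscher1983]
* A. González-Arroyo, C. P. Korthals Altes, Nucl. Phys. B311 (1988) §2 (twist-eating configurations, their finite stabilisers). [GonzalezarroyoAltes1988]
-/

set_option autoImplicit false

noncomputable section

open scoped Quaternion Matrix BigOperators
open Literature.MathematicalPhysics.QuantumFieldTheory hiding SU2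
open Literature.MathematicalPhysics.QuantumLattice
open Summit.QuantumFields.YangMills.Theorems.FemtoTransferGap
open Summit.QuantumFields.YangMills.Theorems.FemtoTransferGap.TT
open Summit.QuantumFields.YangMills.Theorems.FemtoTransferGap.TwoLattice
open Summit.QuantumFields.YangMills.Theorems.FemtoTransferGap.TwoLattice.Flat
open Summit.QuantumFields.YangMills.Theorems.FemtoTransferGap.TwoLattice.Cov
open Summit.QuantumFields.YangMills.Theorems.ToronValleyVolume.Lojasiewicz
open Summit.QuantumFields.YangMills.Theorems.TwistEaterVolume.Quadratic
open Summit.QuantumFields.YangMills.Theorems.QuantitativeLaplace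

namespace Summit.QuantumFields.YangMills.Theorems.VirialFluxGap.RingDeficit

/-! ## §1 Quaternions: almost commuting with a pure orthonormal pair forces closeness to `±1` -/

/-- Bessel's inequality for an orthonormal pair of vectors in `ℝ³`, in components. [folklore] -/
theorem bessel_orthonormal_pair₃ {v₁ v₂ v₃ n₁ n₂ n₃ a₁ a₂ a₃ : ℝ} (hn : n₁ * n₁ + n₂ * n₂ + n₃ * n₃ = 1) (ha : a₁ * a₁ + a₂ * a₂ + a₃ * a₃ = 1)
    (hna : a₁ * n₁ + a₂ * n₂ + a₃ * n₃ = 0) :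
    (v₁ * n₁ + v₂ * n₂ + v₃ * n₃) ^ 2 + (v₁ * a₁ + v₂ * a₂ + v₃ * a₃) ^ 2 ≤ v₁ * v₁ + v₂ * v₂ + v₃ * v₃ := by
  have e1 : (v₁ * n₁ + v₂ * n₂ + v₃ * n₃) ^ 2 * (n₁ * n₁ + n₂ * n₂ + n₃ * n₃) = (v₁ * n₁ + v₂ * n₂ + v₃ * n₃) ^ 2 := by rw [hn, mul_one]
  have e2 : (v₁ * a₁ + v₂ * a₂ + v₃ * a₃) ^ 2 * (a₁ * a₁ + a₂ * a₂ + a₃ * a₃) = (v₁ * a₁ + v₂ * a₂ + v₃ * a₃) ^ 2 := by rw [ha, mul_one]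
  have e3 : (v₁ * n₁ + v₂ * n₂ + v₃ * n₃) * (v₁ * a₁ + v₂ * a₂ + v₃ * a₃) * (a₁ * n₁ + a₂ * n₂ + a₃ * n₃) = 0 := by rw [hna, mul_zero]
  linarith [sq_nonneg (v₁ - (v₁ * n₁ + v₂ * n₂ + v₃ * n₃) * n₁ - (v₁ * a₁ + v₂ * a₂ + v₃ * a₃) * a₁),
    sq_nonneg (v₂ - (v₁ * n₁ + v₂ * n₂ + v₃ * n₃) * n₂ - (v₁ * a₁ + v₂ * a₂ + v₃ * a₃) * a₂),
    sq_nonneg (v₃ - (v₁ * n₁ + v₂ * n₂ + v₃ * n₃) * n₃ - (v₁ * a₁ + v₂ * a₂ + v₃ * a₃) * a₃), e1, e2, e3]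

/-- ★ **Almost commuting with a pure orthonormal pair ⇒ close to `±1`.**  For unit quaternions `a, n, v` with `a, n` PURE and with
orthogonal imaginary parts: if `‖vn − nv‖ ≤ ε₁` and `‖va − av‖ ≤ ε₂` then `‖v − σ‖ ≤ ε₁ + ε₂` for `σ = 1` or `σ = −1` (the imaginary part of
`v` is almost parallel to both axes, hence short: `|Im v|² ≤ (ε₁² + ε₂²)/4`; renormalising the real part costs the same). [folklore] -/
theorem exists_sign_norm_sub_le_of_comm_pure_pair {a n v : ℍ} (ha : ‖a‖ = 1) (hn : ‖n‖ = 1) (hv : ‖v‖ = 1) (hare : a.re = 0)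
    (hnre : n.re = 0) (hperp : a.imI * n.imI + a.imJ * n.imJ + a.imK * n.imK = 0) {ε₁ ε₂ : ℝ} (h1 : ‖v * n - n * v‖ ≤ ε₁)
    (h2 : ‖v * a - a * v‖ ≤ ε₂) : ∃ σ : ℝ, (σ = 1 ∨ σ = -1) ∧ ‖v - (σ : ℍ)‖ ≤ ε₁ + ε₂ := by
  have hε₁ : 0 ≤ ε₁ := (norm_nonneg _).trans h1
  have hε₂ : 0 ≤ ε₂ := (norm_nonneg _).trans h2
  have hn1 := imDot_eq_one_of_pure hn hnre
  have ha1 := imDot_eq_one_of_pure ha hare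
  -- Lagrange: `|Im v|²·1 − (Im v·Im n)² ≤ ε₁²/4`, same with `a`
  have hcn := cross_sq_le_of_comm v n h1
  have hca := cross_sq_le_of_comm v a h2
  rw [hn1, mul_one] at hcn
  rw [ha1, mul_one] at hca
  -- Bessel for the orthonormal pair `(n, a)`
  have hb := bessel_orthonormal_pair₃ (v₁ := v.imI) (v₂ := v.imJ) (v₃ := v.imK) hn1 ha1 hperp
  set m : ℝ := v.imI * v.imI + v.imJ * v.imJ + v.imK * v.imK with hm
  have hm0 : 0 ≤ m := imDot_self_nonneg v
  have hmle : m ≤ (ε₁ ^ 2 + ε₂ ^ 2) / 4 := by linarith [hcn, hca, hb]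
  -- `re² + m = 1`
  have hunit : v.re ^ 2 + m = 1 := by rw [hm, ← norm_sq_eq_re_sq_add_imDot, hv, one_pow]
  have hm1 : m ≤ 1 := by nlinarith [sq_nonneg v.re]
  set σ : ℝ := (if 0 ≤ v.re then (1:ℝ) else -1) with hσ
  have hσ1 : σ = 1 ∨ σ = -1 := by rw [hσ]; split_ifs <;> simp
  refine ⟨σ, hσ1, ?_⟩
  -- `‖v − σ‖² = (re − σ)² + m = (|re| − 1)² + m ≤ m² + m ≤ 2m ≤ (ε₁²+ε₂²)/2 ≤ (ε₁+ε₂)²`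
  have hreσ : (v.re - σ) ^ 2 = (|v.re| - 1) ^ 2 := by
    rw [hσ]; split_ifs with h
    · rw [abs_of_nonneg h]
    · rw [abs_of_neg (lt_of_not_ge h)]; ring
  have habs1 : |v.re| ≤ 1 := by
    rw [← sq_le_one_iff_abs_le_one]; linarith
  have habs0 : 0 ≤ |v.re| := abs_nonneg _
  have hgap : (|v.re| - 1) ^ 2 ≤ m := by
    -- `(|re| − 1)² ≤ 1 − |re| ≤ 1 − re² = m`
    have hsqabs : v.re ^ 2 = |v.re| ^ 2 := (sq_abs v.re).symm
    have hm' : m = 1 - |v.re| ^ 2 := by linarith [hunit, hsqabs]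
    have hx : 0 ≤ |v.re| * (1 - |v.re|) := mul_nonneg habs0 (sub_nonneg.2 habs1)
    have h1' : 1 - |v.re| ≤ m := by rw [hm']; linarith [hx]
    calc (|v.re| - 1) ^ 2 = (1 - |v.re|) * (1 - |v.re|) := by ring
      _ ≤ (1 - |v.re|) * 1 := mul_le_mul_of_nonneg_left (by linarith) (sub_nonneg.2 habs1)
      _ ≤ m := by linarith
  have hnormsq : ‖v - (σ : ℍ)‖ ^ 2 = (v.re - σ) ^ 2 + m := by
    rw [norm_sq_eq_re_sq_add_imDot (v - (σ : ℍ))]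
    simp only [Quaternion.re_sub, Quaternion.imI_sub, Quaternion.imJ_sub, Quaternion.imK_sub, Quaternion.re_coe,
      Quaternion.imI_coe, Quaternion.imJ_coe, Quaternion.imK_coe, sub_zero]
    rw [← hm]
  have hsq : ‖v - (σ : ℍ)‖ ^ 2 ≤ (ε₁ + ε₂) ^ 2 := by
    rw [hnormsq, hreσ]
    have hε : (ε₁ ^ 2 + ε₂ ^ 2) / 4 + (ε₁ ^ 2 + ε₂ ^ 2) / 4 ≤ (ε₁ + ε₂) ^ 2 := by
      linarith [mul_nonneg hε₁ hε₂, sq_nonneg ε₁, sq_nonneg ε₂]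
    linarith [hgap, hmle, hε]
  have h0 : 0 ≤ ε₁ + ε₂ := by positivity
  exact (pow_le_pow_iff_left₀ (norm_nonneg _) h0 (by norm_num : (2:ℕ) ≠ 0)).1 hsq

/-! ## §2 `SU(2)`: a twist-eater pair has the quantitative stabiliser `{±1}` -/

/-- Conjugation transport of the Frobenius distance: `fd(aPb, aRb) = fd(P, R)`. [folklore] -/
theorem fd_conj_transport (a b P R : SU2) : fd (a * P * b) (a * R * b) = fd P R := by
  rw [fd_mul_right, fd_mul_left]

/-- `centreElem true = negOne`, `centreElem false = 1`. [folklore] -/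
theorem centreElem_true : centreElem true = negOne := by simp [centreElem]

/-- `centreElem false = 1`. [folklore] -/
theorem centreElem_false : centreElem false = 1 := by simp [centreElem]

/-- `su2Quat (centreElem b) = ±1` as a real scalar quaternion. [folklore] -/
theorem su2Quat_centreElem_eq_coe (b : Bool) : su2Quat (centreElem b) = ((if b then (-1 : ℝ) else 1 : ℝ) : ℍ) := by
  cases b
  · rw [centreElem_false, su2Quat_one]; simp
  · rw [centreElem_true, su2Quat_negOne]; simp

/-- ★ **A twist-eater pair has the quantitative stabiliser `{±1}`.**  If `c w c⁻¹ = −w` in `SU(2)` and `u` satisfies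
`fd(u w u⁻¹, w) ≤ ε₁`, `fd(u c u⁻¹, c) ≤ ε₂`, then `fd(u, centreElem b) ≤ 2(ε₁ + ε₂)` for some `b`. [cite: GonzalezarroyoAltes1988, §2] -/
theorem exists_centreElem_fd_le_of_twistEater {c w u : SU2} (hcw : c * w * c⁻¹ = negOne * w) {ε₁ ε₂ : ℝ}
    (h1 : fd (u * w * u⁻¹) w ≤ ε₁) (h2 : fd (u * c * u⁻¹) c ≤ ε₂) : ∃ b : Bool, fd u (centreElem b) ≤ 2 * (ε₁ + ε₂) := by
  -- exact anticommutation in `ℍ`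
  have h0 : ‖su2Quat c * su2Quat w + su2Quat w * su2Quat c‖ ≤ 0 := by
    have h := norm_quat_twist_le_fd c w true
    rw [hcw, ← centreElem_true, fd_self] at h
    simpa [sub_neg_eq_add] using h
  have hanti : su2Quat c * su2Quat w = -(su2Quat w * su2Quat c) :=
    eq_neg_of_add_eq_zero_left (norm_le_zero_iff.1 h0)
  obtain ⟨hcre, hwre, hperp⟩ := pure_of_anticomm (norm_su2Quat c) (norm_su2Quat w) hanti
  -- the two commutator bounds in `ℍ`
  have hc1 : ‖su2Quat u * su2Quat w - su2Quat w * su2Quat u‖ ≤ ε₁ := by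
    have h := norm_quat_twist_le_fd u w false
    rw [centreElem_false, one_mul] at h
    simpa using h.trans h1
  have hc2 : ‖su2Quat u * su2Quat c - su2Quat c * su2Quat u‖ ≤ ε₂ := by
    have h := norm_quat_twist_le_fd u c false
    rw [centreElem_false, one_mul] at h
    simpa using h.trans h2
  obtain ⟨σ, hσ, hnear⟩ := exists_sign_norm_sub_le_of_comm_pure_pair (norm_su2Quat c) (norm_su2Quat w) (norm_su2Quat u)
    hcre hwre hperp hc1 hc2
  -- back to `SU(2)`: `fd ≤ 2‖q − q‖`
  rcases hσ with rfl | rfl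
  · refine ⟨false, ?_⟩
    have e : su2Quat (centreElem false) = ((1 : ℝ) : ℍ) := by rw [su2Quat_centreElem_eq_coe]; simp
    calc fd u (centreElem false) ≤ 2 * ‖su2Quat u - su2Quat (centreElem false)‖ := fd_le_two_mul_norm_su2Quat_sub _ _
      _ ≤ 2 * (ε₁ + ε₂) := by rw [e]; linarith
  · refine ⟨true, ?_⟩
    have e : su2Quat (centreElem true) = ((-1 : ℝ) : ℍ) := by rw [su2Quat_centreElem_eq_coe]; simp
    calc fd u (centreElem true) ≤ 2 * ‖su2Quat u - su2Quat (centreElem true)‖ := fd_le_two_mul_norm_su2Quat_sub _ _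
      _ ≤ 2 * (ε₁ + ε₂) := by rw [e]; linarith

/-! ## §3 ★★ Rings: a gauge transformation that hardly moves a twisted flat ring is close to `±1` everywhere -/

section Ring

variable {L : ℕ} [NeZero L]

omit [NeZero L] in
/-- A tree edge is not a wrap edge: `x_k ≠ −1`. [folklore] -/
theorem apply_ne_neg_one_of_treeEdge [Fact (1 < L)] {x : Site 3 L} {k : Fin 3} (he : treeEdge (x, k) = true) : x k ≠ -1 := by
  rw [treeEdge_iff] at he
  rcases he with ⟨hk, h⟩ | ⟨hk, -, h⟩ | ⟨hk, -, -, h⟩ <;> simp only at hk <;> subst hk <;> exact h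

/-- ★★ **Quantitative stabiliser rigidity of the twisted flat rings (per-link form).**  For `L ≥ 2`, `z ≠ 0`, a zero `Q` of `F_z` and ANY
gauge field `h`: if `h` moves every link of the slice `Q₀` by at most `δ` (Frobenius) and conjugation by `h` moves the seam field by at
most `δ` at every site, then `h` is within `9L·δ` of a central constant `centreElem b` at EVERY site.  (Comb normal form
✓`exists_combGauge_of_ringDeficit_eq_zero`; the conjugated field `t h t⁻¹` is `δ`-constant along the tree, almost commutes with a twisted wrap
and with the seam constant; ✓`exists_centreElem_fd_le_of_twistEater`.) [cite: Luscher1983, §2] [cite: GonzalezarroyoAltes1988, §2] -/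
theorem exists_centreElem_fd_le_of_ringDeficit_eq_zero (hL : 2 ≤ L) {z : Fin 3 → Bool} (hz : z ≠ fun _ => false)
    {Q : (Fin (2 * L - 1 + 1) → GaugeConfig 3 L SU2) × (Site 3 L → SU2)} (hQ : ringDeficit L z Q = 0)
    (h : Site 3 L → SU2) {δ : ℝ} (hδ : 0 ≤ δ)
    (hlink : ∀ e : Edge 3 L, fd (gaugeTransform h (Q.1 0) e) (Q.1 0 e) ≤ δ)
    (hseam : ∀ x : Site 3 L, fd (h x * Q.2 x * (h x)⁻¹) (Q.2 x) ≤ δ) :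
    ∃ b : Bool, ∀ x : Site 3 L, fd (h x) (centreElem b) ≤ 9 * L * δ := by
  haveI : Fact (1 < L) := ⟨hL⟩
  obtain ⟨lam, hlamc, hlam0, hflip, hstay⟩ := exists_twistSign hL z
  obtain ⟨t, w, c, _hww, hcw, hsl, hsm⟩ := exists_combGauge_of_ringDeficit_eq_zero hL z hlamc hlam0 hflip hstay Q hQ
  -- a twisted direction
  obtain ⟨k₀, hk₀⟩ : ∃ k, z k = true := by
    by_contra hcon
    apply hz
    funext k
    have hk : ¬ z k = true := fun hk => hcon ⟨k, hk⟩
    simpa using hk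
  have hL1 : (1 : ℝ) ≤ (L : ℝ) := by exact_mod_cast NeZero.one_le
  -- the conjugated field `g = t h t⁻¹` and the unfolding of the gauge action on one link
  set g : Site 3 L → SU2 := fun x => t x * h x * (t x)⁻¹ with hg
  set F : GaugeConfig 3 L SU2 := combFlat w with hF
  have hGT : ∀ (s : Site 3 L → SU2) (X : GaugeConfig 3 L SU2) (x : Site 3 L) (k : Fin 3),
      gaugeTransform s X (x, k) = s x * X (x, k) * (s (x.shift k))⁻¹ := fun _ _ _ _ => rfl
  -- link closeness, transported to comb gauge
  have hlink' : ∀ (x : Site 3 L) (k : Fin 3), fd (g x * F (x, k) * (g (x.shift k))⁻¹) (F (x, k)) ≤ δ := by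
    intro x k
    have h1 := hlink (x, k)
    rw [hsl 0, hGT, hGT] at h1
    simp only [Pi.inv_apply, inv_inv] at h1
    have key : fd (g x * F (x, k) * (g (x.shift k))⁻¹) (F (x, k)) =
        fd (h x * ((t x)⁻¹ * F (x, k) * t (x.shift k)) * (h (x.shift k))⁻¹) ((t x)⁻¹ * F (x, k) * t (x.shift k)) := by
      rw [← fd_conj_transport (t x)⁻¹ (t (x.shift k)) (g x * F (x, k) * (g (x.shift k))⁻¹) (F (x, k))]
      congr 1
      simp only [hg, mul_inv_rev, inv_inv, mul_assoc, inv_mul_cancel_left, inv_mul_cancel, mul_one]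
    rw [key]
    exact h1
  -- along tree edges `g` is `δ`-constant, hence `3(L−1)δ`-close to `u = g 0` everywhere
  have htree : ∀ e : Edge 3 L, treeEdge e = true → fd (g (e.1.shift e.2)) (g e.1) ≤ δ := by
    rintro ⟨x, k⟩ he
    have hxk : x k ≠ -1 := apply_ne_neg_one_of_treeEdge he
    have h1 := hlink' x k
    rw [hF, combFlat_apply] at h1
    simp only [if_neg hxk, mul_one] at h1
    -- `fd (g x (g x')⁻¹) 1 = fd (g x) (g x')`
    have e : fd (g x * (g (x.shift k))⁻¹) 1 = fd (g x) (g (x.shift k)) := by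
      rw [← fd_mul_right (g (x.shift k)) (g x * (g (x.shift k))⁻¹) 1, inv_mul_cancel_right, one_mul]
    rw [e] at h1
    rw [fd_comm]
    exact h1
  set u : SU2 := g 0 with hu
  have hconst : ∀ x : Site 3 L, fd (g x) u ≤ 3 * ((L : ℝ) - 1) * δ := fun x => fd_sub_base_le_of_treeEdge hδ htree x
  -- the wrap edge of the twisted direction: `u` almost commutes with `w k₀`
  have hwrap : fd (u * w k₀ * u⁻¹) (w k₀) ≤ 3 * ((L : ℝ) - 1) * δ + δ := by
    set m : Site 3 L := mk3 (if k₀ = 0 then (-1 : ZMod L) else 0) (if k₀ = 1 then (-1 : ZMod L) else 0)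
      (if k₀ = 2 then (-1 : ZMod L) else 0) with hm
    have hshift : m.shift k₀ = 0 := wrapEdge_shift k₀
    have hmk : m k₀ = -1 := by rw [hm]; fin_cases k₀ <;> simp [mk3]
    have h1 := hlink' m k₀
    rw [hshift, hF, combFlat_apply] at h1
    simp only [if_pos hmk] at h1
    rw [← hu] at h1
    have e : fd (u * w k₀ * u⁻¹) (g m * w k₀ * u⁻¹) = fd u (g m) := by rw [fd_mul_right, fd_mul_right]
    calc fd (u * w k₀ * u⁻¹) (w k₀) ≤ fd (u * w k₀ * u⁻¹) (g m * w k₀ * u⁻¹) + fd (g m * w k₀ * u⁻¹) (w k₀) := fd_triangle _ _ _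
      _ ≤ 3 * ((L : ℝ) - 1) * δ + δ := by rw [e, fd_comm]; exact add_le_add (hconst m) h1
  -- the seam at the origin: `u` almost commutes with `c`
  have hseam0 : fd (u * c * u⁻¹) c ≤ δ := by
    have h1 := hseam 0
    rw [hsm 0, hlam0, one_mul] at h1
    have key : fd (u * c * u⁻¹) c = fd (h 0 * ((t 0)⁻¹ * c * t 0) * (h 0)⁻¹) ((t 0)⁻¹ * c * t 0) := by
      rw [← fd_conj_transport (t 0)⁻¹ (t 0) (u * c * u⁻¹) c]
      congr 1
      simp only [hu, hg, mul_inv_rev, inv_inv, mul_assoc, inv_mul_cancel_left, inv_mul_cancel, mul_one]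
    rw [key]
    exact h1
  -- the twist-eater relation in the twisted direction and the quantitative stabiliser
  have hcw₀ : c * w k₀ * c⁻¹ = negOne * w k₀ := by rw [hcw k₀, hk₀, centreElem_true]
  obtain ⟨b, hb⟩ := exists_centreElem_fd_le_of_twistEater hcw₀ hwrap hseam0
  refine ⟨b, fun x => ?_⟩
  -- `fd (h x) (centreElem b) = fd (g x) (centreElem b) ≤ fd (g x) u + fd u (centreElem b)`
  have hcentral : t x * centreElem b * (t x)⁻¹ = centreElem b := by
    rw [← centre_comm (centreElem_mem_center b) (t x), mul_assoc, mul_inv_cancel, mul_one]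
  have e : fd (h x) (centreElem b) = fd (g x) (centreElem b) := by
    rw [← fd_conj_transport (t x) (t x)⁻¹ (h x) (centreElem b), hcentral]
  rw [e]
  calc fd (g x) (centreElem b) ≤ fd (g x) u + fd u (centreElem b) := fd_triangle _ _ _
    _ ≤ 3 * ((L : ℝ) - 1) * δ + 2 * (3 * ((L : ℝ) - 1) * δ + δ + δ) := add_le_add (hconst x) hb
    _ = (9 * (L : ℝ) - 5) * δ := by ring
    _ ≤ 9 * L * δ := by nlinarith

/-! ## §4 ★★ The same in the chordal ring distance of the Theses (tube ∕ separation currency) -/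

/-- ★★ **Quantitative stabiliser rigidity in the chordal ring distance.**  For `L ≥ 2`, `z ≠ 0`, a zero `Q` of `F_z` and ANY gauge field `h`,
with `D = ringDist(h·Q, Q) = Σ_i (6L³ − timeCoupling((h·Q)_i, Q_i)) + Σ_x (2 − Re tr((h g h⁻¹)_x g_x⁻¹))` (the inlined chordal distance of the
Theses, `h·Q` in the form of ✓`…RingGaugeAction`): `fd(h_x, centreElem b) ≤ 18L·√D` at every site, for some `b`.  This is the first half of
the slice property `hslice` of ✓`laplaceMethod_quantitative_orbit`: a gauge transformation mapping one point of a transversal slice at `Q`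
to another is `O(L·radius)`-close to the stabiliser `{±1}`. [cite: Luscher1983, §2] [cite: GonzalezarroyoAltes1988, §2] -/
theorem exists_centreElem_fd_le_sqrt_ringDist (hL : 2 ≤ L) {z : Fin 3 → Bool} (hz : z ≠ fun _ => false)
    {Q : (Fin (2 * L - 1 + 1) → GaugeConfig 3 L SU2) × (Site 3 L → SU2)} (hQ : ringDeficit L z Q = 0)
    (h : Site 3 L → SU2) :
    ∃ b : Bool, ∀ x : Site 3 L, fd (h x) (centreElem b) ≤ 18 * L * Real.sqrt
      ((∑ i : Fin (2 * L - 1 + 1), (6 * (L : ℝ) ^ 3 - timeCoupling su2Rep (gaugeTransform h (Q.1 i)) (Q.1 i))) +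
        ∑ x : Site 3 L, (2 - ((su2Rep ((h * Q.2 * h⁻¹) x * (Q.2 x)⁻¹)).trace).re)) := by
  set D : ℝ := (∑ i : Fin (2 * L - 1 + 1), (6 * (L : ℝ) ^ 3 - timeCoupling su2Rep (gaugeTransform h (Q.1 i)) (Q.1 i))) +
        ∑ x : Site 3 L, (2 - ((su2Rep ((h * Q.2 * h⁻¹) x * (Q.2 x)⁻¹)).trace).re) with hD
  -- every summand is a (sum of) squared quaternion distance(s)
  have hseam_eq : ∀ x : Site 3 L, 2 - ((su2Rep ((h * Q.2 * h⁻¹) x * (Q.2 x)⁻¹)).trace).re =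
      ‖su2Quat (h x * Q.2 x * (h x)⁻¹) - su2Quat (Q.2 x)‖ ^ 2 := fun x => by
    rw [ConstTube.re_trace_su2Rep_mul_inv_eq_norm]; simp only [Pi.mul_apply, Pi.inv_apply]; ring
  have hslice_nonneg : ∀ i : Fin (2 * L - 1 + 1), 0 ≤ 6 * (L : ℝ) ^ 3 - timeCoupling su2Rep (gaugeTransform h (Q.1 i)) (Q.1 i) :=
    fun i => by linarith [timeCoupling_su2Rep_le (gaugeTransform h (Q.1 i)) (Q.1 i)]
  have hseam_nonneg : ∀ x : Site 3 L, 0 ≤ 2 - ((su2Rep ((h * Q.2 * h⁻¹) x * (Q.2 x)⁻¹)).trace).re := fun x => by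
    rw [hseam_eq]; positivity
  have hS1 : 0 ≤ ∑ i : Fin (2 * L - 1 + 1), (6 * (L : ℝ) ^ 3 - timeCoupling su2Rep (gaugeTransform h (Q.1 i)) (Q.1 i)) :=
    Finset.sum_nonneg fun i _ => hslice_nonneg i
  have hS2 : 0 ≤ ∑ x : Site 3 L, (2 - ((su2Rep ((h * Q.2 * h⁻¹) x * (Q.2 x)⁻¹)).trace).re) :=
    Finset.sum_nonneg fun x _ => hseam_nonneg x
  have hD0 : 0 ≤ D := add_nonneg hS1 hS2
  -- per link of the slice `Q₀`
  have hlink : ∀ e : Edge 3 L, fd (gaugeTransform h (Q.1 0) e) (Q.1 0 e) ≤ 2 * Real.sqrt D := by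
    intro e
    have h0 : ‖su2Quat (gaugeTransform h (Q.1 0) e) - su2Quat (Q.1 0 e)‖ ^ 2 ≤ D := by
      calc ‖su2Quat (gaugeTransform h (Q.1 0) e) - su2Quat (Q.1 0 e)‖ ^ 2
          ≤ ∑ e' : Edge 3 L, ‖su2Quat (gaugeTransform h (Q.1 0) e') - su2Quat (Q.1 0 e')‖ ^ 2 :=
            Finset.single_le_sum (f := fun e' : Edge 3 L => ‖su2Quat (gaugeTransform h (Q.1 0) e') - su2Quat (Q.1 0 e')‖ ^ 2)
              (fun _ _ => by positivity) (Finset.mem_univ e)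
        _ = 6 * (L : ℝ) ^ 3 - timeCoupling su2Rep (gaugeTransform h (Q.1 0)) (Q.1 0) := (timeCoupling_deficit_eq _ _).symm
        _ ≤ ∑ i : Fin (2 * L - 1 + 1), (6 * (L : ℝ) ^ 3 - timeCoupling su2Rep (gaugeTransform h (Q.1 i)) (Q.1 i)) :=
            Finset.single_le_sum (f := fun i : Fin (2 * L - 1 + 1) => 6 * (L : ℝ) ^ 3 - timeCoupling su2Rep (gaugeTransform h (Q.1 i)) (Q.1 i))
              (fun i _ => hslice_nonneg i) (Finset.mem_univ 0)
        _ ≤ D := by rw [hD]; linarith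
    have h1 : ‖su2Quat (gaugeTransform h (Q.1 0) e) - su2Quat (Q.1 0 e)‖ ≤ Real.sqrt D := (Real.le_sqrt (norm_nonneg _) hD0).2 h0
    linarith [fd_le_two_mul_norm_su2Quat_sub (gaugeTransform h (Q.1 0) e) (Q.1 0 e)]
  -- per site of the seam
  have hseam : ∀ x : Site 3 L, fd (h x * Q.2 x * (h x)⁻¹) (Q.2 x) ≤ 2 * Real.sqrt D := by
    intro x
    have h0 : ‖su2Quat (h x * Q.2 x * (h x)⁻¹) - su2Quat (Q.2 x)‖ ^ 2 ≤ D := by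
      rw [← hseam_eq]
      calc 2 - ((su2Rep ((h * Q.2 * h⁻¹) x * (Q.2 x)⁻¹)).trace).re
          ≤ ∑ y : Site 3 L, (2 - ((su2Rep ((h * Q.2 * h⁻¹) y * (Q.2 y)⁻¹)).trace).re) :=
            Finset.single_le_sum (f := fun y : Site 3 L => 2 - ((su2Rep ((h * Q.2 * h⁻¹) y * (Q.2 y)⁻¹)).trace).re)
              (fun y _ => hseam_nonneg y) (Finset.mem_univ x)
        _ ≤ D := by rw [hD]; linarith
    have h1 : ‖su2Quat (h x * Q.2 x * (h x)⁻¹) - su2Quat (Q.2 x)‖ ≤ Real.sqrt D := (Real.le_sqrt (norm_nonneg _) hD0).2 h0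
    linarith [fd_le_two_mul_norm_su2Quat_sub (h x * Q.2 x * (h x)⁻¹) (Q.2 x)]
  obtain ⟨b, hb⟩ := exists_centreElem_fd_le_of_ringDeficit_eq_zero hL hz hQ h (by positivity) hlink hseam
  exact ⟨b, fun x => (hb x).trans (le_of_eq (by ring))⟩

end Ring

end Summit.QuantumFields.YangMills.Theorems.VirialFluxGap.RingDeficit

end
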